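import Summits.ABC.ABC.Theses.CubicResolventAllowance

/-!
# STUB-IDEAS k1 · gen 15 — companion sketch for `stub_complexCubic` (crux stmt-ABC-22740 `IndexSzpiro`)

Contents: the stub VERBATIM (`Stub`, elaboration check against the current tree), and the two
gen-15 helper statements R1/R2 — the archimedean content of the sign hypothesis `d_K < 0`
("at the unique real place of a complex cubic stem field the `K`-rational 2-torsion model
`y² = x (x² + A x + B)`, `A = 3θ + b`, `B = f'(θ)`, is ANTISYMMETRIC: `B > 0`, `A² < 4B`"),
stated over `ℝ` for a monic cubic `x³ + b x² + c x + d` with real root `θ` and negative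
discriminant. Both are S-sized and proved here (elementary `ring`/`nlinarith`).
No claim on the stub: see `STUB-IDEAS-stub_complexCubic-1.md` (verdict `open-problem`).
-/

-- `Summit.ABC.ABC` is the mandated summit-side namespace (single-conjunct summit).
set_option linter.dupNamespace false

namespace Summit.ABC.ABC.Cruxes.IndexSzpiro.StubIdeas1G15

open Polynomial Literature.Abc

/-- The stub, verbatim (payload.stub.signature). -/
def Stub : Prop :=
  ∀ ε : ℝ, 0 < ε → ∃ C : ℝ, ∀ (W : WeierstrassCurve ℚ) [W.IsElliptic] (K : Type) [Field K]
    [NumberField K], Irreducible W.twoTorsionPolynomial.toPoly → Module.finrank ℚ K = 3 →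
    (∃ θ : K, aeval θ W.twoTorsionPolynomial.toPoly = 0) → NumberField.discr K < 0 →
    (W.minimalDiscriminantNorm ℤ : ℝ) ≤
      C * |(NumberField.discr K : ℝ)| * (W.conductorNorm ℤ : ℝ) ^ (6 + ε)

/-- Sanity: `Stub` is literally the `d_K < 0` half feeding the registered composition
`IndexSzpiro_of : stub_complexCubic → stub_realCubic → IndexSzpiro` (trivial direction only). -/
theorem stub_of_indexSzpiro
    (h : Summit.ABC.ABC.Theses.CubicResolventAllowance.IndexSzpiro) : Stub := by
  intro ε hε
  obtain ⟨C, hC⟩ := h ε hε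
  exact ⟨C, fun W _ K _ _ hirr hdeg hroot _ => hC W K hirr hdeg hroot⟩

/-- **R2 (discriminant through the real root).** For a monic real cubic
`f = x³ + b x² + c x + d` with a root `θ`, writing `f(x + θ) = x (x² + A x + B)` with
`A = 3θ + b`, `B = f'(θ) = 3θ² + 2bθ + c`:  `disc f = (A² − 4B) · B²`
(`disc f` in Mathlib's `Cubic.disc` normal form with `a = 1`). [folklore] -/
theorem disc_eq_of_root (b c d θ : ℝ) (h : θ ^ 3 + b * θ ^ 2 + c * θ + d = 0) :
    b ^ 2 * c ^ 2 - 4 * c ^ 3 - 4 * b ^ 3 * d - 27 * d ^ 2 + 18 * b * c * d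
      = ((3 * θ + b) ^ 2 - 4 * (3 * θ ^ 2 + 2 * b * θ + c)) * (3 * θ ^ 2 + 2 * b * θ + c) ^ 2 := by
  have hd : d = -(θ ^ 3 + b * θ ^ 2 + c * θ) := by linarith
  subst hd
  ring

/-- **R1 (antisymmetry at the real place).** If moreover `disc f < 0` (one real root, a complex
pair — the `d_K < 0` case of the stub, `K = ℚ(θ) ↪ ℝ` its unique real place), then the
translated 2-torsion model `y² = x (x² + A x + B)` is antisymmetric at that place:
`B = f'(θ) > 0` and `A² − 4B < 0` (so `A² < 4B`: the term whose radical is uncontrolled is never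
the largest — the `ℤ`-ordering step of the Pasten–Sepúlveda-Manzo engine, available here and
ONLY here). [folklore] -/
theorem antisymmetric_at_real_place (b c d θ : ℝ) (hroot : θ ^ 3 + b * θ ^ 2 + c * θ + d = 0)
    (hdisc : b ^ 2 * c ^ 2 - 4 * c ^ 3 - 4 * b ^ 3 * d - 27 * d ^ 2 + 18 * b * c * d < 0) :
    0 < 3 * θ ^ 2 + 2 * b * θ + c ∧
      (3 * θ + b) ^ 2 < 4 * (3 * θ ^ 2 + 2 * b * θ + c) := by
  have hid := disc_eq_of_root b c d θ hroot
  rw [hid] at hdisc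
  have hB2 : 0 ≤ (3 * θ ^ 2 + 2 * b * θ + c) ^ 2 := sq_nonneg _
  have hneg : (3 * θ + b) ^ 2 - 4 * (3 * θ ^ 2 + 2 * b * θ + c) < 0 := by
    by_contra hge
    have := mul_nonneg (not_lt.mp hge) hB2
    linarith
  have hA2 : 0 ≤ (3 * θ + b) ^ 2 := sq_nonneg _
  constructor
  · linarith
  · linarith

end Summit.ABC.ABC.Cruxes.IndexSzpiro.StubIdeas1G15
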